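/-
Cell pub-hodgecm2 (COR-CM = stage 2 of the Hodge ladder), seat p2 (binder prover 2/8), gen 22
(prover-pub-hodgecm2-p2-g22-0), 2026-08-21.  Count-neutral own lane PERL-WEIL-LINE (work item W-a of
`hodge-director/B01-SIZE.md` §4 T2), file F6b.  Theorems only; HC_CM is NOT proved; `PerL` consumed BY NAME.
T5: the only hypothesis binders of Literature/conjecture type are `hP : U_rec.PerL` (resp. the four universe records,
all tree theorems, + `hP`) — joint inhabitation = PerL(U_rec), the cell's standing hypothesis; no contradiction derived.
-/
import Summits.HodgeConjecture.CorCM.PerLWeilLineExotic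
import Summits.HodgeConjecture.CorCM.PerLTypesOfFourTypes
import HarnessLib

/-!
# What `PerL` certifies for ANY four CM abelian threefolds of pairwise inequivalent types of a stage-1 sextic field

The frame / sign-table bookkeeping of `Universe.PerL` is discharged by `PerLTypes.exists_perLData_of_four_types`
(`CorCM/PerLTypesOfFourTypes.lean`): four pairwise inequivalent CM types `τ` of a sextic CM field ARE a PerL
quadruple up to order and conjugation.  Feeding this into `Model.perL_rec_weilLine_exotic_and_algebraic`
(`CorCM/PerLWeilLineExotic.lean`) gives the bookkeeping-free form of the Hodge-theoretic content of stage 1's statement: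

* **`Model.perL_rec_fourTypes_exotic_algebraic`** — `PerL(U_rec)` ⟹ for every sextic CM field `K` with a normal
  closure `j : K → L` of degree `24` or `48`, every quadruple `τ` of pairwise inequivalent CM types of `K`
  (`τ_j ∉ {τ_i, τ̄_i}`), and ANY realisations `(X_i, act_i, θ_i) ⊨ (K; τ_i)` (four CM abelian threefolds — e.g. four
  pairwise non-isogenous simple ones, `GenericCMField.antiVec_ne_of_not_isIsogenous`), there are a reindexing
  `κ : Fin 4 → Fin 4` (injective) and conjugation twists `δ : Fin 4 → Bool` such that the `K`-Weil-line space `W` of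
  the family `(X_{κ i}, act_{κ i} ∘ 𝓞(c)^{δ i})_i` — a 6-dimensional space of `(2,2)` classes on the abelian 12-fold
  `X_{κ 0} ⊕ X_{κ 1} ⊕ X_{κ 2} ⊕ X_{κ 3} ≅ X₀ × X₁ × X₂ × X₃` — is NON-ZERO, consists of HODGE classes, meets the
  divisor ring `D² ⊗ ℂ` TRIVIALLY, and consists of ALGEBRAIC classes.

So, honestly stated: the stage-1 statement `PerL` (on the model universe of record) proves, for every product of four
CM abelian threefolds of pairwise inequivalent types over a sextic CM field of the stage-1 class, the algebraicity of
a non-zero space of EXCEPTIONAL Hodge classes of codimension 2 (the face / Weil-line classes).  It does NOT prove the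
Hodge conjecture for that 12-fold (that needs W-b: these classes and the divisors generate its Hodge ring — seat
b25's `Census/PairFlipSexticFourCore*` / `PairFlipSexticFourCoreTransfer`), let alone HC_CM.
References: PerL v5 §1, Thm 4.4; rfwf v3 Prop 2.2, §4.2; Deligne LNM 900 §5; Shimura 1998 §6.1; B01-SIZE §4 T2.
-/

noncomputable section

open CategoryTheory CategoryTheory.Limits NumberField
open Literature.AlgebraicGeometry.Motives Literature.AlgebraicGeometry.HodgeTheory
open Literature.AlgebraicGeometry.ComplexMultiplication Literature.NumberTheory.Automorphic
open Literature.AlgebraicGeometry.VanGeemen1994 (hodgeClassSpan)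
open Literature.Barriers.HodgeConjecture (divisorClassesSpan)
open Literature.NumberTheory.ComplexMultiplication.CMTypeOps (bar bar_bar)

namespace Summit.HodgeConjecture.CorCM.Model

/-- **`PerL(U_rec)` for ANY four CM threefolds of pairwise inequivalent types (bookkeeping-free form).**  See the
module docstring: reindex by `κ`, twist the `𝓞_K`-actions by complex conjugation where `δ` says so; then the
`K`-Weil-line space of the resulting family on `⨁_i X_{κ i}` is non-zero, Hodge, disjoint from `D² ⊗ ℂ`, and
algebraic.  Single hypothesis beyond the data: `U_rec.PerL`.  NOT HC_CM.
[cite: Shimura1998, §6.1 Corollary of Theorem 2 and Remark, printed p. 41] [cite: Deligne1982HodgeCycles, I §5 (c) (pp. 38–39)] -/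
theorem perL_rec_fourTypes_exotic_algebraic
    (hP : (picardCMUniverse exists_isReal_hodgeModel_holds hodgePQ_independent_of_hodgeModel_holds
      BallQuotient.ballQuotientUniformised_holds cmAbelianVarietyRealised_holds).PerL)
    (K L : CMField) (j : K →+* L) (hN : IsNormalClosure ℚ K L) (h6 : Module.finrank ℚ K = 6)
    (hL : Module.finrank ℚ L = 24 ∨ Module.finrank ℚ L = 48)
    (τ : Fin 4 → CMType K) (hτ : ∀ i i', i ≠ i' → τ i' ≠ τ i ∧ τ i' ≠ bar (τ i))
    (X : Fin 4 → AbelianVariety ℂ) (act : ∀ i, 𝓞 K →+* End (X i))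
    (θ : ∀ i, (K : Type) →+* Module.End ℂ (complexBetti (X i).X 1))
    (hX : ∀ i, IsCMTypeRealisation (τ i) (X i) (act i) (θ i)) :
    ∃ (κ : Fin 4 → Fin 4) (δ : Fin 4 → Bool), Function.Injective κ ∧
      weilLineClasses (fun i => X (κ i))
          (fun i => if δ i then (act (κ i)).comp
            (RingOfIntegers.mapRingHom (IsCMField.complexConj K).toRingEquiv.toRingHom) else act (κ i)) 4 ≠ ⊥ ∧
      weilLineClasses (fun i => X (κ i))
          (fun i => if δ i then (act (κ i)).comp
            (RingOfIntegers.mapRingHom (IsCMField.complexConj K).toRingEquiv.toRingHom) else act (κ i)) 4 ≤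
        hodgeClassSpan (⨁ fun i => X (κ i)).dim (⨁ fun i => X (κ i)).X 2 ∧
      Disjoint
        (weilLineClasses (fun i => X (κ i))
          (fun i => if δ i then (act (κ i)).comp
            (RingOfIntegers.mapRingHom (IsCMField.complexConj K).toRingEquiv.toRingHom) else act (κ i)) 4)
        (divisorClassesSpan (⨁ fun i => X (κ i)).X (⨁ fun i => X (κ i)).dim 2) ∧
      weilLineClasses (fun i => X (κ i))
          (fun i => if δ i then (act (κ i)).comp
            (RingOfIntegers.mapRingHom (IsCMField.complexConj K).toRingEquiv.toRingHom) else act (κ i)) 4 ≤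
        algebraicClasses (⨁ fun i => X (κ i)).X 2 := by
  obtain ⟨φ, ι₁, π, ε, t, hφ, hι, ht, hτt⟩ := PerLTypes.exists_perLData_of_four_types K L j h6 τ hτ
  -- the corner family of `t` in terms of `τ`: slots `π 0, π 2, π 3, π 1`, flips `ε 0, ¬ε 2, ¬ε 3, ε 1`
  let c : Fin 4 → Fin 4 := ![0, 2, 3, 1]
  let κ : Fin 4 → Fin 4 := fun i => π (c i)
  let δ : Fin 4 → Bool := fun i => match i with
    | 0 => ε 0
    | 1 => !(ε 2)
    | 2 => !(ε 3)
    | 3 => ε 1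
  have hκ : Function.Injective κ := fun i i' h => by
    have h' : c i = c i' := π.injective h
    fin_cases i <;> fin_cases i' <;> simp_all [c]
  have hcorner : ∀ i, (![t 0, bar (t 2), bar (t 3), t 1] : Fin 4 → CMType K) i =
      if δ i then bar (τ (κ i)) else τ (κ i) := by
    intro i
    fin_cases i
    · show t 0 = if ε 0 then bar (τ (π 0)) else τ (π 0)
      exact hτt 0
    · show bar (t 2) = if !(ε 2) then bar (τ (π 2)) else τ (π 2)
      rw [hτt 2]; cases ε 2 <;> simp [bar_bar]
    · show bar (t 3) = if !(ε 3) then bar (τ (π 3)) else τ (π 3)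
      rw [hτt 3]; cases ε 3 <;> simp [bar_bar]
    · show t 1 = if ε 1 then bar (τ (π 1)) else τ (π 1)
      exact hτt 1
  refine ⟨κ, δ, hκ, ?_⟩
  refine perL_rec_weilLine_exotic_and_algebraic hP K L j hN h6 hL φ hφ ι₁ hι t ht
    (θ := fun i => if δ i then (θ (κ i)).comp (IsCMField.complexConj K).toRingEquiv.toRingHom else θ (κ i))
    (fun i => ?_)
  rw [hcorner i]
  cases hδ : δ i
  · simp only [Bool.false_eq_true, ↓reduceIte]
    exact hX (κ i)
  · simp only [↓reduceIte]
    exact isCMTypeRealisation_bar_comp_complexConj (hX (κ i))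

end Summit.HodgeConjecture.CorCM.Model

end
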